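import Literature.Topology.FourManifolds.CappellShanesonDeltaMoveProofs
import Literature.Topology.FourManifolds.GompfFramedSpheresProofs
import HarnessLib

/-!
# The Δ-move leaf `gompf2010_deltaMove` is Theorem 2.1 for the single move `A ↦ Δ A`, unframed

Review record (D-0026 split review) for the named fact
`Literature.Topology.FourManifolds.gompf2010_deltaMove` of `CappellShanesonGompfReduction.lean`
(R. Gompf, *More Cappell–Shaneson spheres are standard*, Algebr. Geom. Topol. 10 (2010), Thm 2.1
with §3 ¶3: for a Cappell–Shaneson matrix `A` in standard form the row move `A ↦ Δᵏ A` does not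
change the unordered pair of Cappell–Shaneson spheres). The fact is faithful to the source and is
the interface through which every matrix-level result of loc. cit. §3 (Thm 3.2, Thm 3.4, Cor. 3.5
and their extensions) is consumed in the tree; on its own it is Theorem 2.1 proper (fishtail
neighbourhood and Lemma 2.2), but it is *not* independent debt: it follows (glue proved,
`gompf2010_deltaMove_of_framedTwist'`) from the framed Theorem 2.1 **F** =
`Literature.Topology.FourManifolds.gompf2010_framedTwist`, which `GompfFramedSpheresProofs.lean`
reduces to the single *framed* row move `A ↦ Δ A`.

This file records, as proved reductions and without introducing any named fact, the exact residual
content of the leaf: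

* `Literature.Topology.FourManifolds.exists_gompfSphere_gompfDelta_inv_mul_of_one` — **the move
  `A ↦ Δ⁻¹ A` follows from the move `A ↦ Δ A`** (unframed, on Gompf's concrete spheres
  `X^γ_A = gompfSphere A γ`): conjugate by `P = diag (-1, 1, -1) ∈ SL(3, ℤ)`, which normalises `Δ`
  to `P Δ P⁻¹ = Δ⁻¹` and preserves standard form, and use the conjugation invariance **Cj** proved
  in `GompfConjInvariance.lean` — Gompf, proof of Thm 2.1, last sentence ("To get `X^ε_{δᵏ∘φ}`,
  apply the result for `-k` to `φ⁻¹` and then flip the sign of `t`") and §3 ¶1 (the pair of spheres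
  "only depends on the conjugacy class of `A`");
* `Literature.Topology.FourManifolds.gompf2010_deltaMove_of_rowMove_one` — hence **the leaf
  follows from the unframed single row move**
  `∀ B (standard form, det (B - 1) = 1) β, ∃ β', gompfSphere B β ≅ gompfSphere (Δ B) β'`
  (all `k` by `gompf2010_deltaMove_of_gompfSphere_one`, Lemma 2.2: "The general case then follows
  from the case `k = 1`");
* `Literature.Topology.FourManifolds.gompf2010_deltaMove_of_framedRowMove_one` — and a fortiori
  from the residual form of **F**, the single framed row move
  `gompfSphere B β ≅ gompfSphere (Δ B) (β.deltaLeft 1)` (`gompf2010_framedTwist_of_one`).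

So the discharge of `gompf2010_deltaMove` is one line once `gompf2010_framedTwist_holds` (or just
the unframed single row move) lands; no further decomposition of the leaf is meaningful. (D-0026,
2026-08-15: the Dehn-twist rendering "Theorem 2.1 on the torus" formerly isolated as a second
named fact in `CappellShanesonDeltaMove.lean` was proved equivalent to this leaf and has been
merged back into it; the `…_of_rowMove_one` / `…_of_framedRowMove_one` reductions are recorded
once, for `gompf2010_deltaMove`.)

## References

* R. E. Gompf, *More Cappell–Shaneson spheres are standard*, Algebr. Geom. Topol. 10 (2010)
  1665–1681, doi:10.2140/agt.2010.10.1665 (arXiv:0908.1914): Thm 2.1 and its proof (last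
  sentence), Lemma 2.2 (proof: reduction to `k = 1`), §3 ¶1 (conjugacy invariance), §3 ¶3 (the
  matrix `Δ`, row and column moves), §4 ¶3. [GompfAGT2010]
-/

open scoped Manifold ContDiff Topology
open Set Function

noncomputable section

namespace Literature.Topology.FourManifolds

universe u

/-! ### The flip `P = diag (-1, 1, -1)` normalising `Δ` to its inverse -/

section Flip

/-- **`Δ` is conjugate to its inverse in `SL(3, ℤ)` by an involution preserving standard form**:
there is `P ∈ SL(3, ℤ)` (namely `P = diag (-1, 1, -1)`) with `P P = 1`, `P Δ P = Δ⁻¹`, and such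
that `P A P` is in standard form whenever `A` is (`(P A P) e₁ = -P A e₁ = -P e₃ = e₃`). With
`Δ = 1 + N`, `N = -e₁ e₂ᵀ + e₃ e₂ᵀ`, `N² = 0`: `P N P = -N`, so `P Δ P = 1 - N = Δ⁻¹`. [folklore] -/
theorem exists_flip_gompfDelta :
    ∃ P : Matrix.SpecialLinearGroup (Fin 3) ℤ, P * P = 1 ∧ P * gompfDelta * P = gompfDelta⁻¹ ∧
      ∀ A : Matrix.SpecialLinearGroup (Fin 3) ℤ, IsGompfStandardForm A →
        IsGompfStandardForm (P * A * P) := by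
  let d : Fin 3 → ℤ := ![-1, 1, -1]
  have hd : (Matrix.diagonal d).det = 1 := by
    rw [Matrix.det_diagonal, Fin.prod_univ_three]
    rfl
  set P : Matrix.SpecialLinearGroup (Fin 3) ℤ := ⟨Matrix.diagonal d, hd⟩ with hP
  have hPcoe : (P : Matrix (Fin 3) (Fin 3) ℤ) = Matrix.diagonal d := rfl
  refine ⟨P, ?_, ?_, ?_⟩
  · ext i j
    rw [Matrix.SpecialLinearGroup.coe_mul, Matrix.SpecialLinearGroup.coe_one, hPcoe,
      Matrix.diagonal_mul_diagonal]
    fin_cases i <;> fin_cases j <;> simp [d]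
  · rw [← _root_.zpow_neg_one]
    ext i j
    rw [Matrix.SpecialLinearGroup.coe_mul, Matrix.SpecialLinearGroup.coe_mul, coe_gompfDelta_zpow,
      coe_gompfDelta, hPcoe]
    simp only [Matrix.mul_diagonal, Matrix.diagonal_mul]
    fin_cases i <;> fin_cases j <;> simp [d]
  · intro A hA
    obtain ⟨h0, h1, h2⟩ := hA
    refine ⟨?_, ?_, ?_⟩ <;>
      simp only [Matrix.SpecialLinearGroup.coe_mul, hPcoe, Matrix.mul_diagonal,
        Matrix.diagonal_mul] <;>
      simp [d, h0, h1, h2]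

end Flip

/-! ### The move `A ↦ Δ⁻¹ A` from the move `A ↦ Δ A` -/

section InverseMove

/-- **The unframed move `A ↦ Δ⁻¹ A` from the unframed move `A ↦ Δ A`.** Suppose that for every
Cappell–Shaneson matrix `B` in standard form and every framing path `β` the concrete sphere
`gompfSphere B β` is diffeomorphic to `gompfSphere (Δ B) β'` for some `β'`. Then the same holds with
`Δ⁻¹` in place of `Δ`: with the involution `P = diag (-1, 1, -1)` (`exists_flip_gompfDelta`),
`X^γ_A ≅ X^{PγP}_{PAP}` (Cj) `≅ X^{β'}_{Δ PAP}` (the move, `P A P` being again in standard form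
with `det (· - 1) = 1`) `≅ X^{Pβ'P}_{P Δ P A P P}` (Cj) and `P Δ P A P P = Δ⁻¹ A`. This is
the symmetry in the last sentence of Gompf's proof of Theorem 2.1 ("apply the result for `-k` to
`φ⁻¹` and then flip the sign of `t`") realised inside `SL(3, ℤ)` by the conjugacy invariance of
§3 ¶1. [cite: GompfAGT2010, Thm 2.1 (proof, last sentence) and §3 ¶1 (conjugacy invariance)] -/
theorem exists_gompfSphere_gompfDelta_inv_mul_of_one
    (h₁ : ∀ (B : Matrix.SpecialLinearGroup (Fin 3) ℤ), IsGompfStandardForm B →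
      ((B : Matrix (Fin 3) (Fin 3) ℤ) - 1).det = 1 →
      ∀ β : SmoothMatrixPath (slRealMatrix B),
        ∃ β' : SmoothMatrixPath (slRealMatrix (gompfDelta * B)),
          Nonempty (gompfSphere B β ≃ₘ⟮𝓡 4, 𝓡 4⟯ gompfSphere (gompfDelta * B) β'))
    (A : Matrix.SpecialLinearGroup (Fin 3) ℤ) (hA : IsGompfStandardForm A)
    (hdet : ((A : Matrix (Fin 3) (Fin 3) ℤ) - 1).det = 1) (γ : SmoothMatrixPath (slRealMatrix A)) :
    ∃ γ' : SmoothMatrixPath (slRealMatrix (gompfDelta⁻¹ * A)),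
      Nonempty (gompfSphere A γ ≃ₘ⟮𝓡 4, 𝓡 4⟯ gompfSphere (gompfDelta⁻¹ * A) γ') := by
  obtain ⟨P, hPP, hPΔ, hPstd⟩ := exists_flip_gompfDelta
  have hPinv : P⁻¹ = P := inv_eq_of_mul_eq_one_right hPP
  -- the conjugated matrix `B = P A P⁻¹` is again a Cappell–Shaneson matrix in standard form
  have hB : IsGompfStandardForm (P * A * P⁻¹) := by
    rw [hPinv]
    exact hPstd A hA
  have hdetB : (((P * A * P⁻¹ : Matrix.SpecialLinearGroup (Fin 3) ℤ) :
      Matrix (Fin 3) (Fin 3) ℤ) - 1).det = 1 := by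
    rw [det_coe_conj_sub_one]
    exact hdet
  -- Cj: `X^{PγP⁻¹}_{PAP⁻¹} ≅ X^γ_A`
  obtain ⟨e₁⟩ := gompf2010_conj_invariance_holds A P γ
  -- the move `B ↦ Δ B`
  obtain ⟨β', h₂⟩ := h₁ (P * A * P⁻¹) hB hdetB (γ.conj P)
  -- Cj again: `X^{Pβ'P⁻¹}_{P (Δ B) P⁻¹} ≅ X^{β'}_{Δ B}`
  obtain ⟨e₃⟩ := gompf2010_conj_invariance_holds (gompfDelta * (P * A * P⁻¹)) P β'
  -- and `P (Δ B) P⁻¹ = (P Δ P) A (P P) = Δ⁻¹ A`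
  have heq : P * (gompfDelta * (P * A * P⁻¹)) * P⁻¹ = gompfDelta⁻¹ * A := by
    rw [hPinv, ← hPΔ]
    calc P * (gompfDelta * (P * A * P)) * P = P * gompfDelta * P * A * (P * P) := by
          simp only [mul_assoc]
      _ = P * gompfDelta * P * A := by rw [hPP, mul_one]
  obtain ⟨γ', h₄⟩ := exists_gompfSphere_diffeomorph_of_eq heq (β'.conj P)
  exact ⟨γ', nonempty_diffeomorph_trans ⟨e₁.symm⟩
    (nonempty_diffeomorph_trans h₂ (nonempty_diffeomorph_trans ⟨e₃.symm⟩ h₄))⟩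

end InverseMove

/-! ### The leaf from the single row move -/

section Leaves

/-- **The Δ-move leaf `gompf2010_deltaMove` from the unframed single row move `A ↦ Δ A` on
Gompf's concrete spheres**: the move with `Δ⁻¹` follows by
`exists_gompfSphere_gompfDelta_inv_mul_of_one`, all `k ∈ ℤ` by induction
(`gompf2010_deltaMove_of_gompfSphere_one`; Gompf, proof of Lemma 2.2: "The general case then
follows from the case `k = 1`"), and the classification of Cappell–Shaneson spheres by
straightenings is proved (`gompf2010_straightening_classification_holds`). So the residual
content of the leaf is exactly Theorem 2.1 of loc. cit. for `M = T³`, a linear monodromy in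
standard form, the Dehn twist `δ ≃ Δ` and `k = 1`, with no bookkeeping of framings. [cite: GompfAGT2010, Thm 2.1, Lemma 2.2 (proof, reduction to k = 1) and §3 ¶3] -/
theorem gompf2010_deltaMove_of_rowMove_one
    (h₁ : ∀ (B : Matrix.SpecialLinearGroup (Fin 3) ℤ), IsGompfStandardForm B →
      ((B : Matrix (Fin 3) (Fin 3) ℤ) - 1).det = 1 →
      ∀ β : SmoothMatrixPath (slRealMatrix B),
        ∃ β' : SmoothMatrixPath (slRealMatrix (gompfDelta * B)),
          Nonempty (gompfSphere B β ≃ₘ⟮𝓡 4, 𝓡 4⟯ gompfSphere (gompfDelta * B) β')) :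
    gompf2010_deltaMove.{u} :=
  gompf2010_deltaMove_of_gompfSphere_one h₁ (exists_gompfSphere_gompfDelta_inv_mul_of_one h₁)

/-- The framed single row move (the residual form of **F**, `gompf2010_framedTwist_of_one`) gives
the unframed one: take `β' = β.deltaLeft 1` (transported along `Δ ^ 1 = Δ`). [cite: GompfAGT2010, §4 ¶3 (X^{τ·σ}_B = X^σ_A for B = Δᵏ A or A Δᵏ)] -/
theorem exists_gompfSphere_gompfDelta_mul_of_framedRowMove_one
    (h1 : ∀ (B : Matrix.SpecialLinearGroup (Fin 3) ℤ), IsGompfStandardForm B →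
      ((B : Matrix (Fin 3) (Fin 3) ℤ) - 1).det = 1 → ∀ (β : SmoothMatrixPath (slRealMatrix B)),
        Nonempty (gompfSphere B β ≃ₘ⟮𝓡 4, 𝓡 4⟯
          gompfSphere (gompfDelta ^ (1 : ℤ) * B) (β.deltaLeft 1)))
    (B : Matrix.SpecialLinearGroup (Fin 3) ℤ) (hB : IsGompfStandardForm B)
    (hdet : ((B : Matrix (Fin 3) (Fin 3) ℤ) - 1).det = 1) (β : SmoothMatrixPath (slRealMatrix B)) :
    ∃ β' : SmoothMatrixPath (slRealMatrix (gompfDelta * B)),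
      Nonempty (gompfSphere B β ≃ₘ⟮𝓡 4, 𝓡 4⟯ gompfSphere (gompfDelta * B) β') := by
  obtain ⟨β', h⟩ := exists_gompfSphere_diffeomorph_of_eq
    (show gompfDelta ^ (1 : ℤ) * B = gompfDelta * B by rw [zpow_one]) (β.deltaLeft 1)
  exact ⟨β', nonempty_diffeomorph_trans (h1 B hB hdet β) h⟩

/-- **`gompf2010_deltaMove` from the residual form of F**, the single *framed* row move
`gompfSphere B β ≅ gompfSphere (Δ B) (β.deltaLeft 1)` for `B` in standard form with
`det (B - 1) = 1` (`gompf2010_framedTwist_of_one` followed by `gompf2010_deltaMove_of_framedTwist'`;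
equivalently `gompf2010_deltaMove_of_rowMove_one` after forgetting the framing). [cite: GompfAGT2010, Thm 2.1, §3 ¶3 and §4 ¶3] -/
theorem gompf2010_deltaMove_of_framedRowMove_one
    (h1 : ∀ (B : Matrix.SpecialLinearGroup (Fin 3) ℤ), IsGompfStandardForm B →
      ((B : Matrix (Fin 3) (Fin 3) ℤ) - 1).det = 1 → ∀ (β : SmoothMatrixPath (slRealMatrix B)),
        Nonempty (gompfSphere B β ≃ₘ⟮𝓡 4, 𝓡 4⟯
          gompfSphere (gompfDelta ^ (1 : ℤ) * B) (β.deltaLeft 1))) :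
    gompf2010_deltaMove.{u} :=
  gompf2010_deltaMove_of_framedTwist' (gompf2010_framedTwist_of_one h1)


end Leaves

end Literature.Topology.FourManifolds
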